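import Summits.Ventures.QEC.Census.CertBits
import HarnessLib

/-!
# Parity step of the CSS distance-certificate checker: an all-ones row combination forces even weights
# (BZ-CHECKER-SPEC §C2 / §L7, plan/CERT-FORMAT.md v1.2 §5.5)

Venture QEC (cell `qec`), kernel end of the certificate pipeline, word layer of `Census/CertBits.lean` (type-10).
qec-search-1's BZ-CHECKER-SPEC, check C2: «if `even_witness` present: `xorRows(Hsyn, even_witness) = 2^n − 1`;
then `wmax_eff := wmax − (wmax mod 2)`», justified by proposition L7: «`xorRows(Hsyn, even_witness) = all-ones ⇒`
every `z ∈ ker Hsyn` has even weight (`|z| ≡ Σ_rows ⟨row, z⟩ ≡ 0`). Hence "no nontrivial logical of weight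
`≤ wmax_eff`" ⇒ "… `≤ wmax`" when `wmax` is odd.» This file proves exactly that, in the checker's vocabulary
(`xorRows`, `synZero`, `popc`, `rowMatrix`, `ofBits`) and in the vector vocabulary (`rowMatrix n H *ᵥ x = 0 ⇒
Even (hammingNorm x)`), plus the lifting step for the `Z`- and `X`-distances of a `CSSCode` whose syndrome matrix is a
`rowMatrix`: an even-weight kernel lets a certified lower bound `wmax − wmax % 2 < d` be read as `wmax < d`.

* `parityOK n Hsyn sel : Bool` — the check C2 (`xorRows Hsyn sel == 2^n − 1`);
* `sum_eq_natCast_hammingNorm` — over `𝔽₂`, `Σᵢ xᵢ = |x| (mod 2)`;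
* `even_hammingNorm_of_parityOK` (vector form of L7), `popc_mod_two_of_parityOK` (word form);
* `lt_of_even_of_sub_mod_two_lt` — the arithmetic of `wmax_eff`;
* `CSSCode.lt_dZ_of_parityOK` / `CSSCode.lt_dX_of_parityOK` — for `C : CSSCode … (Fin n)` with `C.HX = rowMatrix n Hsyn`
  (resp. `C.HZ = …`): `parityOK` and `wmax − wmax % 2 < d^Z` give `wmax < d^Z`.

HONEST FRAMING: pure `𝔽₂` linear algebra; certifies nothing by itself — it is one conjunct of the checker's `bz`
branch (type-10 consumes it). No `native_decide`; no new axioms.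
-/

namespace Summit.Ventures.QEC.Census

open Matrix Finset Literature.InformationTheory.QuantumCodes

/-! ### The check -/

/-- **Check C2 (parity)**: the XOR of the rows `Hsyn[i]`, `i ∈ sel`, is the all-ones word `2^n − 1` on the `n`
qubits. (definition) -/
def parityOK (n : ℕ) (Hsyn : List ℕ) (sel : List ℕ) : Bool :=
  xorRows Hsyn sel == 2 ^ n - 1

/-- The all-ones word is the all-ones vector. -/
theorem ofBits_two_pow_sub_one (n : ℕ) : ofBits n (2 ^ n - 1) = fun _ => 1 := by
  funext i
  simp [ofBits, Nat.testBit_two_pow_sub_one, i.isLt]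

/-- A successful parity check puts the all-ones vector in the row space of the syndrome matrix. -/
theorem allOnes_mem_rowSpace_of_parityOK {n : ℕ} {Hsyn sel : List ℕ} (h : parityOK n Hsyn sel = true) :
    (fun _ => (1 : ZMod 2)) ∈ rowSpace (rowMatrix n Hsyn) := by
  have hx : xorRows Hsyn sel = 2 ^ n - 1 := by simpa [parityOK] using h
  have := ofBits_xorRows_mem_rowSpace n Hsyn sel
  rwa [hx, ofBits_two_pow_sub_one] at this

/-! ### Weights mod 2 -/

/-- Over `𝔽₂` every coordinate is `0` or `1`, so `xᵢ = [xᵢ ≠ 0]`. -/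
theorem zmod2_eq_ite {Q : Type*} (x : Q → ZMod 2) (i : Q) : x i = if x i = 0 then 0 else 1 := by
  generalize x i = a
  revert a; decide

/-- Over `𝔽₂`: `Σᵢ xᵢ = |x|` (the Hamming weight read mod 2). -/
theorem sum_eq_natCast_hammingNorm {Q : Type*} [Fintype Q] [DecidableEq Q] (x : Q → ZMod 2) :
    ∑ i, x i = (hammingNorm x : ZMod 2) := by
  calc ∑ i, x i = ∑ i, (if x i = 0 then (0 : ZMod 2) else 1) :=
        Finset.sum_congr rfl fun i _ => zmod2_eq_ite x i
    _ = ∑ i ∈ Finset.univ.filter (fun i => x i ≠ 0), (1 : ZMod 2) := by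
        rw [Finset.sum_filter]
        refine Finset.sum_congr rfl fun i _ => ?_
        by_cases h : x i = 0 <;> simp [h]
    _ = ((Finset.univ.filter fun i => x i ≠ 0).card : ZMod 2) := by
        rw [Finset.sum_const, nsmul_eq_mul, mul_one]
    _ = (hammingNorm x : ZMod 2) := by simp [hammingNorm]

/-- `⟨𝟙, x⟩ = |x| (mod 2)`. -/
theorem allOnes_dotProduct {Q : Type*} [Fintype Q] [DecidableEq Q] (x : Q → ZMod 2) :
    (fun _ => (1 : ZMod 2)) ⬝ᵥ x = (hammingNorm x : ZMod 2) := by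
  simp only [dotProduct, one_mul]
  exact sum_eq_natCast_hammingNorm x

/-! ### L7: even weights -/

/-- **L7, vector form**: if the all-ones word is a XOR of rows of `Hsyn`, every kernel vector of `rowMatrix n Hsyn`
has even Hamming weight (`|x| ≡ ⟨𝟙, x⟩ = Σ_rows ⟨row, x⟩ ≡ 0`). -/
theorem even_hammingNorm_of_parityOK {n : ℕ} {Hsyn sel : List ℕ} (h : parityOK n Hsyn sel = true)
    {x : Fin n → ZMod 2} (hx : rowMatrix n Hsyn *ᵥ x = 0) : Even (hammingNorm x) := by
  have h0 := dotProduct_eq_zero_of_mem_rowSpace (allOnes_mem_rowSpace_of_parityOK h) hx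
  rw [dotProduct_comm, allOnes_dotProduct, natCast_zmod2_eq_zero_iff] at h0
  exact Nat.even_iff.mpr h0

/-- **L7, word form**: `parityOK` and `synZero n Hsyn v` give `popc n v` even. -/
theorem popc_mod_two_of_parityOK {n : ℕ} {Hsyn sel : List ℕ} (h : parityOK n Hsyn sel = true) {v : ℕ}
    (hv : synZero n Hsyn v = true) : popc n v % 2 = 0 := by
  have := even_hammingNorm_of_parityOK h ((synZero_iff n Hsyn v).1 hv)
  rw [hammingNorm_ofBits] at this
  exact Nat.even_iff.mp this

/-! ### Lifting a lower bound past the odd threshold -/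

/-- The arithmetic of `wmax_eff = wmax − wmax % 2`: an EVEN number exceeding `wmax_eff` exceeds `wmax`. -/
theorem lt_of_even_of_sub_mod_two_lt {w m : ℕ} (hm : Even m) (h : w - w % 2 < m) : w < m := by
  obtain ⟨t, rfl⟩ := hm
  omega

/-- **Lift for `d^Z`**: for a CSS code on `Fin n` whose `X`-check matrix IS `rowMatrix n Hsyn`, a successful parity
check makes every `Z`-logical candidate (`H^X x = 0`) even, so a certified `wmax − wmax % 2 < d^Z` yields `wmax < d^Z`.
(For `d^Z = 0`, i.e. no `Z`-logical, the hypothesis is impossible.) -/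
theorem CSSCode.lt_dZ_of_parityOK {RZ : Type*} [Fintype RZ] {n : ℕ} {Hsyn sel : List ℕ}
    (C : CSSCode (Fin Hsyn.length) RZ (Fin n)) (hC : C.HX = rowMatrix n Hsyn)
    (h : parityOK n Hsyn sel = true) {wmax : ℕ} (hlb : wmax - wmax % 2 < C.dZ) : wmax < C.dZ := by
  refine lt_of_even_of_sub_mod_two_lt ?_ hlb
  -- `d^Z > 0`, so it is attained by a `Z`-logical `x` with `H^X x = 0`
  have hpos : 0 < C.dZ := lt_of_le_of_lt (Nat.zero_le _) hlb
  obtain ⟨v, hv, hv'⟩ := C.dZ_pos_iff.mp hpos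
  obtain ⟨x, hx, -, hxd⟩ := C.exists_hammingNorm_eq_dZ ⟨v, hv, hv'⟩
  rw [← hxd]
  exact even_hammingNorm_of_parityOK h (by rw [← hC]; exact hx)

/-- **Lift for `d^X`** (roles exchanged: the parity check is on `H^Z`). -/
theorem CSSCode.lt_dX_of_parityOK {RX : Type*} [Fintype RX] {n : ℕ} {Hsyn sel : List ℕ}
    (C : CSSCode RX (Fin Hsyn.length) (Fin n)) (hC : C.HZ = rowMatrix n Hsyn)
    (h : parityOK n Hsyn sel = true) {wmax : ℕ} (hlb : wmax - wmax % 2 < C.dX) : wmax < C.dX := by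
  have := CSSCode.lt_dZ_of_parityOK C.swap (by simpa using hC) h (by simpa using hlb)
  simpa using this

end Summit.Ventures.QEC.Census
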